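import Mathlib.Analysis.RCLike.Basic
import Literature.MathematicalPhysics.QuantumLattice.GrassmannIntegralPartial
import Literature.MathematicalPhysics.QuantumLattice.GrassmannIntegralSubstitution
import HarnessLib

/-!
# Dimock, *Quantum electrodynamics on the 3-torus I*, Appendix B «fermion norms and integrals»: the norm
# `‖F‖_h = Σ_r (h^r/r!) ‖f_r‖₁` (299) on a finite Grassmann algebra, LEMMA 19 `‖FG‖_h ≤ ‖F‖_h ‖G‖_h` and
# LEMMA 20 `‖F(AΨ)‖_{h′} ≤ ‖F‖_h` for `h′‖A‖_{(1)} ≤ h` — PROVED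

statement-level skeleton of published theorems with citation tags; proofs where landed; nothing here is a claim about the Yang–Mills mass gap

**Citation header (reproduction of PUBLISHED work).** J. Dimock, *Quantum electrodynamics on the 3-torus. I. First
step*, arXiv:math-ph/0210020 (2002) [Dimock2002QED3TorusI], **Appendix B**, p.62 of the arXiv-v1 text layer
`paper:arxiv-math-ph_0210020` (`p.NN Lnn` = PDF page ∕ text-layer line). Writer seat p11 (literature-prover-lit-balaban-p11-g15-0),
YM LIT SWEEP item (c) D12.

**The printed text (p.62 L1–24).** *"We consider the Grassman algebra generated by `Ψ_α(x), Ψ̄_α(x)` … Let `ξ` stand for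
`(0,α,x)` or `(1,α,x)` … Then the `Ψ(ξ)` generate the algebra and any element can be uniquely written
`F(Ψ) = Σ_r (1/r!) Σ_{ξ₁,…,ξ_r} f_r(ξ₁,…,ξ_r) Ψ(ξ₁)⋯Ψ(ξ_r)` (298) where the coefficients `f_r` are totally antisymmetric
functions. We define a norm `‖·‖_h` depending on a parameter `h > 0` by `‖F‖_h = Σ_r (h^r/r!) ‖f_r‖₁` (299) where `‖f_r‖₁`
is the `ℓ¹` norm."* **LEMMA 19** *"`‖FG‖_h ≤ ‖F‖_h ‖G‖_h`. Proof. `H = FG` has the coefficients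
`h_r = Σ_{s+t=r} (r!/(s!t!)) alt(f_s ⊗ g_t)` (300) and hence `‖h_r‖₁ ≤ Σ_{s+t=r} (r!/(s!t!)) ‖f_s‖₁‖g_t‖₁` (301). Now multiplying
by `h^r/r!` and summing over `r` gives the result."*

**What is here.** The generators `Ψ(ξ)` are the generators `θ_i`, `i ∈ ι` (any finite linearly ordered index type —
for the paper, `ι = {0,1} × spinor × sites`), of the tree's Grassmann algebra `QuantumLattice.GrassmannAlgebra 𝕜 ι = ⋀(ι → 𝕜)`
with its monomial basis `θ_S = θ_{i₁}⋯θ_{i_r}` (`i₁ < ⋯ < i_r` enumerating `S : Finset ι`; `grassmannBasis`, REUSED).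
(299) IN THE MONOMIAL BASIS: writing `F = Σ_S c_S θ_S`, the antisymmetric kernel of (298) is `f_r(ξ₁,…,ξ_r) =
sgn(σ)·c_S` when `(ξ₁,…,ξ_r)` is the ordering `σ` of an `r`-set `S` and `0` on tuples with a repetition, so
`‖f_r‖₁ = r!·Σ_{#S=r} |c_S|` and (299) reads **`‖F‖_h = Σ_S h^{#S} |c_S|`** — this is the definition `hNorm` below
(the `r!` of (298) and the `1/r!` of (299) cancel; no factorials survive). LEMMA 19 is then `hNorm_mul_le`, proved by
the printed mechanism in this basis: the coefficient of `θ_U` in `FG` is `Σ_{S ⊔ T = U} ±c_S d_T` (the tree's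
`grassmannBasis_mul_grassmannBasis_of_disjoint ∕ _of_not_disjoint`: `θ_Sθ_T = ±θ_{S∪T}` for disjoint supports, `0`
otherwise — this is (300)), so `|coeff_U(FG)| ≤ Σ_{S⊔T=U} |c_S||d_T|` (301) and `h^{#U} = h^{#S}h^{#T}`; summing over `U`
and dropping the disjointness constraint gives `‖F‖_h‖G‖_h`. Also: `hNorm_nonneg`, `hNorm_grassmannBasis`
(`‖θ_S‖_h = h^{#S}`), `hNorm_one`, `hNorm_smul`, `hNorm_add_le`, `hNorm_sum_le`, `hNorm_pow_le`.
(v1.1) p.62 L25–36, p.63 L1: *"Next consider transformations of the form `F′(Ψ) = F(AΨ)` where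
`(AΨ)(ξ) = Σ_{ξ′} A(ξ,ξ′)Ψ(ξ′)`. We can estimate the effect in terms of the norm `‖A‖_{(1)} = sup_ξ Σ_{ξ′}|A(ξ,ξ′)|` (302).
**LEMMA 20** Let `F′(Ψ) = F(AΨ)`. If `h′‖A‖_{(1)} ≤ h` then `‖F′‖_{h′} ≤ ‖F‖_h` (303). Proof. `F′` has coefficients
`f′_r(ξ′₁,…,ξ′_r) = Σ_{ξ₁,…,ξ_r} f_r(ξ₁,…,ξ_r) Π_i A(ξ_i,ξ′_i)` (304) … Hence `‖f′_r‖ ≤ (‖A‖_{(1)})^r‖f_r‖`. Now multiply by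
`(h′)^r/r!` and sum over `r`"* — here `subst A` (the algebra endomorphism `θ_ξ ↦ Σ_{ξ′} A ξ ξ′ θ_{ξ′}`, Mathlib's
`ExteriorAlgebra.map`; `subst_gen`), `opNormOne` (302), and `hNorm_subst_le` (LEMMA 20), proved through the monomial
form of (304): `‖θ_S(AΨ)‖_{h′} ≤ (h′‖A‖_{(1)})^{#S}` (`hNorm_subst_grassmannBasis_le`, by LEMMA 19 along the increasing
product `θ_S = θ_{i₁}⋯θ_{i_r}`), then linearity and the triangle inequality.

Scalars: `𝕜` with `[RCLike 𝕜]` (`ℝ` or `ℂ`), as in the tree's `GrassmannKernels.lean`. Not here: (305)–(310) and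
LEMMAS 21–25 (Gaussian integrals). No named facts, no `sorry`.
-/

noncomputable section

open Finset

namespace Literature.MathematicalPhysics.QuantumFieldTheory.Dimock2011to13

namespace QED3TorusI

open Literature.MathematicalPhysics.QuantumLattice
open Literature.MathematicalPhysics.QuantumLattice.GrassmannAlgebra

variable {𝕜 : Type*} [RCLike 𝕜] {ι : Type*} [LinearOrder ι] [Fintype ι]

/-- The coefficient `c_S(F)` of the monomial `θ_S` in `F`. [cite: Dimock2002QED3TorusI, App. B (298) p.62 L4–8] -/
abbrev coeff (F : GrassmannAlgebra 𝕜 ι) (S : Finset ι) : 𝕜 := (grassmannBasis 𝕜 ι).repr F S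

/-- **Dimock's norm (299)** in the monomial basis: `‖F‖_h = Σ_S h^{#S} |c_S(F)|`
(`= Σ_r (h^r/r!)‖f_r‖₁` for the antisymmetric kernels `f_r` of (298), see the module docstring).
[cite: Dimock2002QED3TorusI, App. B (299) p.62 L9–13] -/
def hNorm (h : ℝ) (F : GrassmannAlgebra 𝕜 ι) : ℝ := ∑ S : Finset ι, h ^ S.card * ‖coeff F S‖

omit [LinearOrder ι] [Fintype ι] in
/-- Unfolding. [cite: Dimock2002QED3TorusI, App. B (299) p.62 L9–13] -/
theorem hNorm_def [LinearOrder ι] [Fintype ι] (h : ℝ) (F : GrassmannAlgebra 𝕜 ι) :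
    hNorm h F = ∑ S : Finset ι, h ^ S.card * ‖coeff F S‖ := rfl

/-- `‖F‖_h ≥ 0` for `h ≥ 0`. [cite: Dimock2002QED3TorusI, App. B (299) p.62 L9–13 («a norm»)] -/
theorem hNorm_nonneg {h : ℝ} (hh : 0 ≤ h) (F : GrassmannAlgebra 𝕜 ι) : 0 ≤ hNorm h F :=
  Finset.sum_nonneg fun _ _ => mul_nonneg (pow_nonneg hh _) (norm_nonneg _)

/-- `‖0‖_h = 0`. [cite: Dimock2002QED3TorusI, App. B (299) p.62 L9–13 («a norm»)] -/
@[simp] theorem hNorm_zero (h : ℝ) : hNorm h (0 : GrassmannAlgebra 𝕜 ι) = 0 := by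
  simp [hNorm, coeff]

/-- `‖θ_S‖_h = h^{#S}`: a monomial of degree `r` has norm `h^r` (its kernel `f_r` has `‖f_r‖₁ = r!`).
[cite: Dimock2002QED3TorusI, App. B (299) p.62 L9–13] -/
theorem hNorm_grassmannBasis (h : ℝ) (S : Finset ι) : hNorm h (grassmannBasis 𝕜 ι S) = h ^ S.card := by
  simp only [hNorm, coeff, Module.Basis.repr_self]
  rw [Finset.sum_eq_single S]
  · simp
  · intro T _ hTS
    simp [hTS.symm]
  · intro hS
    exact absurd (Finset.mem_univ S) hS

/-- `‖1‖_h = 1` (`1 = θ_∅`). [cite: Dimock2002QED3TorusI, App. B (299) p.62 L9–13] -/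
theorem hNorm_one (h : ℝ) : hNorm h (1 : GrassmannAlgebra 𝕜 ι) = 1 := by
  have h1 : (1 : GrassmannAlgebra 𝕜 ι) = grassmannBasis 𝕜 ι ∅ := by
    simp [grassmannBasis, Module.Basis.ExteriorAlgebra]
  rw [h1, hNorm_grassmannBasis, Finset.card_empty, pow_zero]

/-- Homogeneity `‖cF‖_h = |c|‖F‖_h`. [cite: Dimock2002QED3TorusI, App. B (299) p.62 L9–13 («a norm»)] -/
theorem hNorm_smul (h : ℝ) (c : 𝕜) (F : GrassmannAlgebra 𝕜 ι) : hNorm h (c • F) = ‖c‖ * hNorm h F := by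
  simp only [hNorm, coeff, map_smul, Finsupp.smul_apply, smul_eq_mul, norm_mul, Finset.mul_sum]
  exact Finset.sum_congr rfl fun S _ => by ring

/-- Triangle inequality `‖F + G‖_h ≤ ‖F‖_h + ‖G‖_h` (`h ≥ 0`). [cite: Dimock2002QED3TorusI, App. B (299) p.62 L9–13 («a norm»)] -/
theorem hNorm_add_le {h : ℝ} (hh : 0 ≤ h) (F G : GrassmannAlgebra 𝕜 ι) :
    hNorm h (F + G) ≤ hNorm h F + hNorm h G := by
  simp only [hNorm, coeff, map_add, Finsupp.add_apply, ← Finset.sum_add_distrib, ← mul_add]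
  exact Finset.sum_le_sum fun S _ => mul_le_mul_of_nonneg_left (norm_add_le _ _) (pow_nonneg hh _)

/-! ## (300)–(301): coefficients of a product -/

/-- The coefficient of `θ_U` in `θ_S θ_T`: of modulus `≤ 1`, and `0` unless `S, T` are disjoint with `S ∪ T = U`
(the tree's `θ_Sθ_T = ±θ_{S∪T}` ∕ `= 0`). This is the monomial form of (300).
[cite: Dimock2002QED3TorusI, App. B (300) p.62 L15–18] -/
theorem norm_coeff_grassmannBasis_mul_le (S T U : Finset ι) :
    ‖coeff (grassmannBasis 𝕜 ι S * grassmannBasis 𝕜 ι T) U‖ ≤ if Disjoint S T ∧ S ∪ T = U then 1 else 0 := by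
  by_cases hd : Disjoint S T
  · rw [grassmannBasis_mul_grassmannBasis_of_disjoint 𝕜 hd]
    simp only [coeff, map_smul, Module.Basis.repr_self, Finsupp.smul_apply, smul_eq_mul]
    by_cases hU : S ∪ T = U
    · subst hU
      simp only [Finsupp.single_eq_same, mul_one, hd, true_and, if_true]
      rcases Int.units_eq_one_or (berezinSign T (S ∪ T)) with h1 | h1 <;> simp [h1]
    · simp [hU, hd]
  · rw [grassmannBasis_mul_grassmannBasis_of_not_disjoint 𝕜 hd]
    simp [coeff, hd]

/-- The coefficient of `θ_U` in `FG` (300): `coeff_U(FG) = Σ_S Σ_T c_S(F) c_T(G) coeff_U(θ_Sθ_T)`.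
[cite: Dimock2002QED3TorusI, App. B (300) p.62 L15–18] -/
theorem coeff_mul (F G : GrassmannAlgebra 𝕜 ι) (U : Finset ι) :
    coeff (F * G) U = ∑ S, ∑ T, coeff F S * coeff G T * coeff (grassmannBasis 𝕜 ι S * grassmannBasis 𝕜 ι T) U := by
  set B := grassmannBasis 𝕜 ι
  have hF : F = ∑ S, coeff F S • B S := (B.sum_repr F).symm
  have hG : G = ∑ T, coeff G T • B T := (B.sum_repr G).symm
  conv_lhs => rw [hF, hG]
  rw [Finset.sum_mul_sum]
  simp only [coeff, smul_mul_smul_comm, map_sum, map_smul, Finsupp.coe_finsetSum, Finset.sum_apply,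
    Finsupp.smul_apply, smul_eq_mul, mul_assoc]

/-- **(301)**: `|coeff_U(FG)| ≤ Σ_{S ⊔ T = U} |c_S(F)| |c_T(G)|`. [cite: Dimock2002QED3TorusI, App. B (301) p.62 L19–22] -/
theorem norm_coeff_mul_le (F G : GrassmannAlgebra 𝕜 ι) (U : Finset ι) :
    ‖coeff (F * G) U‖ ≤ ∑ S, ∑ T, ‖coeff F S‖ * ‖coeff G T‖ * (if Disjoint S T ∧ S ∪ T = U then 1 else 0) := by
  rw [coeff_mul]
  refine (norm_sum_le _ _).trans (Finset.sum_le_sum fun S _ => ?_)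
  refine (norm_sum_le _ _).trans (Finset.sum_le_sum fun T _ => ?_)
  rw [norm_mul, norm_mul]
  exact mul_le_mul_of_nonneg_left (norm_coeff_grassmannBasis_mul_le S T U) (mul_nonneg (norm_nonneg _) (norm_nonneg _))

/-! ## LEMMA 19 -/

/-- The weight bookkeeping: `Σ_U h^{#U}·[S ⊔ T = U] ≤ h^{#S} h^{#T}` (equality when `S, T` are disjoint; `h ≥ 0`) —
*"multiplying by `h^r/r!` and summing over `r`"*. [cite: Dimock2002QED3TorusI, App. B Lemma 19 proof p.62 L23–24] -/
theorem sum_pow_card_indicator_le {h : ℝ} (hh : 0 ≤ h) (S T : Finset ι) :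
    ∑ U : Finset ι, h ^ U.card * (if Disjoint S T ∧ S ∪ T = U then (1 : ℝ) else 0) ≤ h ^ S.card * h ^ T.card := by
  by_cases hd : Disjoint S T
  · rw [Finset.sum_eq_single (S ∪ T)]
    · simp [hd, Finset.card_union_of_disjoint hd, pow_add]
    · intro U _ hU
      simp [Ne.symm hU]
    · intro hU
      exact absurd (Finset.mem_univ _) hU
  · simp only [hd, false_and, if_false, mul_zero, Finset.sum_const_zero]
    exact mul_nonneg (pow_nonneg hh _) (pow_nonneg hh _)

/-- **LEMMA 19.** `‖FG‖_h ≤ ‖F‖_h ‖G‖_h` (`h ≥ 0`; the paper takes `h > 0`).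
[cite: Dimock2002QED3TorusI, App. B Lemma 19 p.62 L14–24] -/
theorem hNorm_mul_le {h : ℝ} (hh : 0 ≤ h) (F G : GrassmannAlgebra 𝕜 ι) :
    hNorm h (F * G) ≤ hNorm h F * hNorm h G := by
  calc hNorm h (F * G)
      = ∑ U, h ^ U.card * ‖coeff (F * G) U‖ := rfl
    _ ≤ ∑ U, h ^ U.card * ∑ S, ∑ T, ‖coeff F S‖ * ‖coeff G T‖ * (if Disjoint S T ∧ S ∪ T = U then 1 else 0) :=
        Finset.sum_le_sum fun U _ => mul_le_mul_of_nonneg_left (norm_coeff_mul_le F G U) (pow_nonneg hh _)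
    _ = ∑ S, ∑ T, ‖coeff F S‖ * ‖coeff G T‖ *
          ∑ U, h ^ U.card * (if Disjoint S T ∧ S ∪ T = U then (1 : ℝ) else 0) := by
        simp only [Finset.mul_sum]
        rw [Finset.sum_comm]
        refine Finset.sum_congr rfl fun S _ => ?_
        rw [Finset.sum_comm]
        refine Finset.sum_congr rfl fun T _ => ?_
        refine Finset.sum_congr rfl fun U _ => ?_
        ring
    _ ≤ ∑ S, ∑ T, ‖coeff F S‖ * ‖coeff G T‖ * (h ^ S.card * h ^ T.card) :=
        Finset.sum_le_sum fun S _ => Finset.sum_le_sum fun T _ =>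
          mul_le_mul_of_nonneg_left (sum_pow_card_indicator_le hh S T) (mul_nonneg (norm_nonneg _) (norm_nonneg _))
    _ = hNorm h F * hNorm h G := by
        rw [hNorm, hNorm, Finset.sum_mul_sum]
        refine Finset.sum_congr rfl fun S _ => Finset.sum_congr rfl fun T _ => ?_
        ring

/-- Corollary: `‖F^n‖_h ≤ ‖F‖_h^n` (`h ≥ 0`). [cite: Dimock2002QED3TorusI, App. B Lemma 19 p.62 L14] -/
theorem hNorm_pow_le {h : ℝ} (hh : 0 ≤ h) (F : GrassmannAlgebra 𝕜 ι) (n : ℕ) :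
    hNorm h (F ^ n) ≤ hNorm h F ^ n := by
  induction n with
  | zero => simp [hNorm_one]
  | succ n ih =>
    rw [pow_succ, pow_succ]
    exact (hNorm_mul_le hh _ _).trans (mul_le_mul_of_nonneg_right ih (hNorm_nonneg hh F))

/-! ## (302)–(304) and LEMMA 20: linear substitutions of the generators (v1.1) -/

/-- The substitution `F ↦ F′`, `F′(Ψ) = F(AΨ)` with `(AΨ)(ξ) = Σ_{ξ′} A(ξ,ξ′)Ψ(ξ′)`: the algebra endomorphism of the
Grassmann algebra sending the generator `θ_ξ` to `Σ_{ξ′} A ξ ξ′ θ_{ξ′}` (Mathlib's `ExteriorAlgebra.map` of the linear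
map `e_ξ ↦ Σ_{ξ′} A ξ ξ′ e_{ξ′}`, i.e. of `Aᵀ` acting on coordinate vectors).
[cite: Dimock2002QED3TorusI, App. B p.62 L25–27 («F′(Ψ) = F(AΨ) where (AΨ)(ξ) = Σ A(ξ,ξ′)Ψ(ξ′)»)] -/
def subst (A : Matrix ι ι 𝕜) : GrassmannAlgebra 𝕜 ι →ₐ[𝕜] GrassmannAlgebra 𝕜 ι :=
  ExteriorAlgebra.map (Matrix.toLin' A.transpose)

/-- `(AΨ)(ξ) = Σ_{ξ′} A(ξ,ξ′) Ψ(ξ′)` on generators. [cite: Dimock2002QED3TorusI, App. B p.62 L25–27] -/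
theorem subst_gen (A : Matrix ι ι 𝕜) (ξ : ι) : subst A (gen 𝕜 ξ) = ∑ ξ', A ξ ξ' • gen 𝕜 ξ' := by
  rw [subst, map_gen]
  refine Finset.sum_congr rfl fun ξ' _ => ?_
  rw [Matrix.toLin'_apply, Matrix.mulVec_single_one]
  rfl

/-- **(302)**: `‖A‖_{(1)} = sup_ξ Σ_{ξ′} |A(ξ,ξ′)|`. [cite: Dimock2002QED3TorusI, App. B (302) p.62 L27–30] -/
def opNormOne (A : Matrix ι ι 𝕜) : ℝ := ⨆ ξ, ∑ ξ', ‖A ξ ξ'‖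

omit [LinearOrder ι] in
/-- Each row sum is below `‖A‖_{(1)}`. [cite: Dimock2002QED3TorusI, App. B (302) p.62 L27–30] -/
theorem sum_norm_le_opNormOne (A : Matrix ι ι 𝕜) (ξ : ι) : ∑ ξ', ‖A ξ ξ'‖ ≤ opNormOne A :=
  le_ciSup (f := fun ξ => ∑ ξ', ‖A ξ ξ'‖) (Set.finite_range _).bddAbove ξ

omit [LinearOrder ι] in
/-- `‖A‖_{(1)} ≥ 0`. [cite: Dimock2002QED3TorusI, App. B (302) p.62 L27–30] -/
theorem opNormOne_nonneg (A : Matrix ι ι 𝕜) : 0 ≤ opNormOne A := by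
  rcases isEmpty_or_nonempty ι with hι | hι
  · simp [opNormOne]
  · exact le_ciSup_of_le (Set.finite_range _).bddAbove (Classical.arbitrary ι)
      (Finset.sum_nonneg fun _ _ => norm_nonneg _)

/-- `‖Σ_{i∈s} F_i‖_h ≤ Σ_{i∈s} ‖F_i‖_h` (`h ≥ 0`). [cite: Dimock2002QED3TorusI, App. B (299) p.62 L9–13 («a norm»)] -/
theorem hNorm_sum_le {h : ℝ} (hh : 0 ≤ h) {α : Type*} (s : Finset α) (F : α → GrassmannAlgebra 𝕜 ι) :
    hNorm h (∑ i ∈ s, F i) ≤ ∑ i ∈ s, hNorm h (F i) := by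
  classical
  induction s using Finset.induction_on with
  | empty => simp
  | insert a s ha ih =>
    rw [Finset.sum_insert ha, Finset.sum_insert ha]
    exact (hNorm_add_le hh _ _).trans (by linarith)

/-- `‖θ_ξ‖_h = h` for a single generator. [cite: Dimock2002QED3TorusI, App. B (299) p.62 L9–13] -/
theorem hNorm_gen (h : ℝ) (ξ : ι) : hNorm h (gen 𝕜 ξ : GrassmannAlgebra 𝕜 ι) = h := by
  rw [← grassmannBasis_singleton, hNorm_grassmannBasis, Finset.card_singleton, pow_one]

/-- The substituted generator: `‖(AΨ)(ξ)‖_{h′} ≤ h′ Σ_{ξ′}|A(ξ,ξ′)| ≤ h′‖A‖_{(1)}` (`h′ ≥ 0`) — the degree-one case of (304).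
[cite: Dimock2002QED3TorusI, App. B (304) p.62 L33–36, p.63 L1] -/
theorem hNorm_subst_gen_le {h' : ℝ} (hh' : 0 ≤ h') (A : Matrix ι ι 𝕜) (ξ : ι) :
    hNorm h' (subst A (gen 𝕜 ξ)) ≤ h' * opNormOne A := by
  rw [subst_gen]
  refine (hNorm_sum_le hh' _ _).trans ?_
  simp only [hNorm_smul, hNorm_gen]
  rw [← Finset.sum_mul, mul_comm]
  exact mul_le_mul_of_nonneg_left (sum_norm_le_opNormOne A ξ) hh'

/-- The substituted monomial: `‖θ_S(AΨ)‖_{h′} ≤ (h′‖A‖_{(1)})^{#S}` — (304) summed: *"`‖f′_r‖ ≤ (‖A‖_{(1)})^r ‖f_r‖`"* for a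
monomial (by LEMMA 19 along the increasing product `θ_S = θ_{i₁}⋯θ_{i_r}`).
[cite: Dimock2002QED3TorusI, App. B (304) p.62 L33–36, p.63 L1] -/
theorem hNorm_subst_grassmannBasis_le {h' : ℝ} (hh' : 0 ≤ h') (A : Matrix ι ι 𝕜) (S : Finset ι) :
    hNorm h' (subst A (grassmannBasis 𝕜 ι S)) ≤ (h' * opNormOne A) ^ S.card := by
  induction S using Finset.induction_on_min with
  | empty => simp [hNorm_one]
  | insert a u hmin ih =>
    have hau : a ∉ u := fun h => lt_irrefl a (hmin a h)
    rw [grassmannBasis_insert_of_forall_lt 𝕜 hmin, map_mul, Finset.card_insert_of_notMem hau, pow_succ, mul_comm]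
    refine (hNorm_mul_le hh' _ _).trans ?_
    exact mul_le_mul (hNorm_subst_gen_le hh' A a) ih (hNorm_nonneg hh' _)
      (mul_nonneg hh' (opNormOne_nonneg A))

/-- **LEMMA 20.** *"Let `F′(Ψ) = F(AΨ)`. If `h′‖A‖_{(1)} ≤ h` then `‖F′‖_{h′} ≤ ‖F‖_h`"* (303) (`h′ ≥ 0`).
[cite: Dimock2002QED3TorusI, App. B Lemma 20 (303) p.62 L31–32, proof (304) p.62 L33 – p.63 L1] -/
theorem hNorm_subst_le {h h' : ℝ} (hh' : 0 ≤ h') (A : Matrix ι ι 𝕜) (hA : h' * opNormOne A ≤ h)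
    (F : GrassmannAlgebra 𝕜 ι) : hNorm h' (subst A F) ≤ hNorm h F := by
  have hF : F = ∑ S, coeff F S • grassmannBasis 𝕜 ι S := ((grassmannBasis 𝕜 ι).sum_repr F).symm
  have hq : 0 ≤ h' * opNormOne A := mul_nonneg hh' (opNormOne_nonneg A)
  conv_lhs => rw [hF]
  rw [map_sum]
  refine (hNorm_sum_le hh' _ _).trans ?_
  rw [hNorm]
  refine Finset.sum_le_sum fun S _ => ?_
  rw [map_smul, hNorm_smul, mul_comm]
  refine mul_le_mul_of_nonneg_right ?_ (norm_nonneg _)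
  exact (hNorm_subst_grassmannBasis_le hh' A S).trans (pow_le_pow_left₀ hq hA _)

end QED3TorusI

end Literature.MathematicalPhysics.QuantumFieldTheory.Dimock2011to13
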